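import Literature.Geometry.Lorentzian.SubdevelopmentBoundaryPoint
import Literature.Geometry.Lorentzian.CorrespondingBoundaryShadow
import Literature.Geometry.Lorentzian.SpacelikePieceDomain
import Literature.Geometry.Lorentzian.NonImprisonmentProofs
import Literature.Geometry.Lorentzian.OpensCausality
import HarnessLib

/-!
# Inside any neighbourhood of a Cauchy hypersurface there is a globally hyperbolic one sharing it
# (the causal shadow neighbourhood)

Let `S` be a Cauchy hypersurface of the connected time-oriented Lorentzian manifold `(M, g, τ)`
(Hausdorff, second countable, boundaryless finite-dimensional model, `C^∞` metric). We prove: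

* `IsCauchyHypersurface.restrict_of_causallyConvex` — **a causally convex open neighbourhood of
  `S` is globally hyperbolic with Cauchy hypersurface `S`**: if `V ⊇ S` is open and contains, with
  every point `x`, the compact "shadows" `J⁻(x) ∩ J⁺(S)` and `J⁺(x) ∩ J⁻(S)`, then `S` is a
  Cauchy hypersurface of the open sub-spacetime `(V, g|_V, τ|_V)`. (At most one crossing holds for
  timelike curves of any open sub-spacetime, `eq_of_mem_of_mem_opens`; an endless timelike curve
  of `V` through `x ∈ I⁺(S)` missing `S` has its past half in `J⁻(x) ∩ J⁺(S) ⊆ V` — it cannot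
  reach `I⁻(S)` without crossing `S`, `exists_mem_of_segment` — so either it has a past endpoint
  in `M`, which lies in that compact subset of `V` and is then an endpoint in `V`, or it is past
  endless in `M` and imprisoned in a compact set, against non-imprisonment under strong causality,
  O'Neill 1983, Ch. 14, Lemma 14.13; time-dually for `x ∈ I⁻(S)`.)
* `IsCauchyHypersurface.exists_causallyConvex_opens_subset` — **the causal shadow neighbourhood**:
  for every open `U ⊇ S` the set `V = {x | J⁻(x) ∩ J⁺(S) ⊆ U ∧ J⁺(x) ∩ J⁻(S) ⊆ U}` is open
  (compactness of `J⁻(p) ∩ J⁺(S)`, closedness of `≤` and of `J⁺(S)`), contains `S`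
  (`J⁻(x) ∩ J⁺(S) ⊆ S` for `x ∈ S`, by achronality and push-up), lies in `U`, and is causally
  convex in the above sense; hence
* `IsCauchyHypersurface.exists_opens_subset_restrict` — **every open neighbourhood `U` of a
  Cauchy hypersurface `S` contains an open `V ⊇ S` of which `S` is still a Cauchy
  hypersurface.**

This is the form in which a Cauchy hypersurface is used to start continuation arguments from data
known only NEAR `S` (e.g. a Killing field on a neighbourhood of `S`: Moncrief 1975, §III;
`Literature.Geometry.Lorentzian.fischerMarsdenMoncrief_killing_development`), reducing them to
the case of a globally hyperbolic subregion sharing the Cauchy hypersurface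
(`SubdevelopmentBoundaryPoint.lean`, `SubdevelopmentUnionCauchy.lean`). It is the elementary
half of "`int D(S)` is globally hyperbolic" (O'Neill 1983, Thm. 14.38; Hawking–Ellis 1973,
Prop. 6.6.3) for neighbourhoods of a whole Cauchy hypersurface. Everything is proved; no
definitions, no named facts (D-0026).

## References

* B. O'Neill, *Semi-Riemannian geometry with applications to relativity*, Academic Press 1983,
  Ch. 14, Lemma 14.13 (p. 407), Lemma 14.29 (p. 415), Thm. 14.38, Lemma 14.40 (pp. 421–423).
  [ONeillSemiRiemannian1983]
* S. W. Hawking, G. F. R. Ellis, *The large scale structure of space-time*, CUP 1973, §6.6,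
  Prop. 6.6.3, Prop. 6.6.6. [HawkingEllis1973CUP]
-/

noncomputable section

open Bundle Set Filter Function TopologicalSpace
open scoped Manifold ContDiff Topology

namespace Literature.Geometry.Lorentzian

variable {E : Type*} [NormedAddCommGroup E] [NormedSpace ℝ E] {H : Type*} [TopologicalSpace H]
  {I : ModelWithCorners ℝ E H} {M : Type*} [TopologicalSpace M] [ChartedSpace H M]
  [IsManifold I ∞ M]

namespace LorentzianMetric

variable [FiniteDimensional ℝ E] [CompleteSpace E] [T2Space M] [SecondCountableTopology M]
  [I.Boundaryless] {n : ℕ∞ω} {g : LorentzianMetric I n M} [g.HasLeviCivita]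
  [CovariantDerivative.ContMDiffCovariantDerivative g.leviCivita 1] (τ : TimeOrientation g)

/-- **No endless timelike curve of a past-shadow-convex `V` misses `S` above `S`.** Let `S` be a
Cauchy hypersurface of the connected `(M, g, τ)` (`C^∞` metric) and `V` open such that
`J⁻(x) ∩ J⁺(S) ⊆ V` for every `x ∈ V`. Then an endless timelike curve of `(V, g|_V, τ|_V)` which
misses `S` has no point in `I⁺(S)`: its past half from such a point `x` would lie in the compact
set `J⁻(x) ∩ J⁺(S) ⊆ V` (it cannot enter `I⁻(S)` without crossing `S`,
`IsCauchyHypersurface.exists_mem_of_segment`), so it either has a past endpoint in `M` inside that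
compact subset of `V` — an endpoint in `V` — or is past endless in `M` and imprisoned in a compact
set (O'Neill 1983, Ch. 14, Lemma 14.13, `IsStronglyCausal.exists_forall_notMem` for `-τ`).
[cite: ONeillSemiRiemannian1983, Ch. 14, Lemma 14.13 (p. 407) and Lemma 14.40 (p. 423)] -/
theorem IsCauchyHypersurface.false_of_isEndlessTimelikeCurve_of_mem_chronologicalFuture
    [ConnectedSpace M] (hn : (∞ : ℕ∞ω) ≤ n)
    (hres : PseudoRiemannianMetric.contMDiff_restrict (I := I) (n := n) (M := M))
    (hτ : τ.contMDiff_restrict) {S : Set M} (hS : g.IsCauchyHypersurface τ S) {V : Opens M}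
    (hconv : ∀ x ∈ V, g.causalPast τ {x} ∩ g.causalFuture τ S ⊆ V)
    {γ : ℝ → V} {s : Set ℝ}
    (hγ : (g.restrict hres V).IsEndlessTimelikeCurve (τ.restrict hres hτ V) γ s)
    (hmiss : ∀ t ∈ s, (γ t : M) ∉ S) {t₀ : ℝ} (ht₀ : t₀ ∈ s)
    (hx : (γ t₀ : M) ∈ g.chronologicalFuture τ S) : False := by
  have hn2 : (2 : ℕ∞ω) ≤ n := le_trans (WithTop.coe_le_coe.mpr le_top) hn
  have hγM : g.IsFutureTimelikeCurveOn τ (Subtype.val ∘ γ) s :=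
    (isFutureTimelikeCurveOn_restrict_iff g τ hres hτ V).1 hγ.2.1
  set x : M := (γ t₀ : M) with hx_def
  have hxV : x ∈ V := (γ t₀).2
  set K : Set M := g.causalPast τ {x} ∩ g.causalFuture τ S with hK
  have hKc : IsCompact K := hS.isCompact_causalPast_inter_causalFuture hn x
  have hKV : K ⊆ V := hconv x hxV
  -- the past half of the curve lies in `K`
  have hpast : ∀ t ∈ s, t ≤ t₀ → (γ t : M) ∈ K := by
    intro t ht htt
    have hseg : g.IsFutureTimelikeCurveOn τ (Subtype.val ∘ γ) (Icc t t₀) :=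
      hγM.mono (hγ.1.out ht ht₀)
    have hJx : (γ t : M) ∈ g.causalPast τ {x} := by
      rcases eq_or_lt_of_le htt with h | hlt
      · rw [h]
        exact subset_causalFuture (g := g) (τ := τ.reverse) _ rfl
      · exact mem_causalPast_singleton_iff.2 (chronologicalFuture_subset_causalFuture _ _ _
          (mem_chronologicalFuture_of_curve hseg le_rfl hlt le_rfl))
    refine ⟨hJx, ?_⟩
    by_contra hJS
    have hI : (γ t : M) ∈ g.chronologicalPast τ S := by
      rcases hS.mem_chronologicalFuture_union_chronologicalPast hn2 (hmiss t ht) with h | h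
      · exact absurd (chronologicalFuture_subset_causalFuture _ _ _ h) hJS
      · exact h
    obtain ⟨t', ht', ht'S⟩ := hS.exists_mem_of_segment hn2 htt hseg hI hx
    exact hmiss t' (hγ.1.out ht ht₀ ht') ht'S
  by_cases hend : ∃ e : M, HasPastEndpoint (Subtype.val ∘ γ) s e
  · -- a past endpoint in `M` lies in `K ⊆ V`: an endpoint in `V`
    obtain ⟨e, he⟩ := hend
    haveI : Nonempty s := ⟨⟨t₀, ht₀⟩⟩
    have hev : ∀ᶠ t : s in atBot, ((Subtype.val ∘ γ) t : M) ∈ K := by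
      filter_upwards [eventually_le_atBot (⟨t₀, ht₀⟩ : s)] with t ht
      exact hpast t t.2 ht
    have heK : e ∈ K := hKc.isClosed.mem_of_tendsto he hev
    exact hγ.2.2.2.2 ⟨e, hKV heK⟩ (hasPastEndpoint_subtypeVal_comp_iff.1 he)
  · -- past endless in `M` and imprisoned in the compact `K`: impossible
    push Not at hend
    have hpe : IsPastEndless (Subtype.val ∘ γ) s := ⟨⟨t₀, ht₀⟩, hend⟩
    have hfe : IsFutureEndless (fun t ↦ (Subtype.val ∘ γ) (-t)) (Neg.neg ⁻¹' s) :=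
      isFutureEndless_comp_neg_iff.2 hpe
    have hSC' : g.IsStronglyCausal τ.reverse := hS.reverse.isStronglyCausal hn
    obtain ⟨u, hu, hforall⟩ := hSC'.exists_forall_notMem hn2 hKc (ordConnected_preimage_neg hγ.1)
      hγM.comp_neg.isFutureCausalCurveOn hfe
    have hu' : max u (-t₀) ∈ Neg.neg ⁻¹' s := by
      rcases le_total u (-t₀) with h | h
      · rw [max_eq_right h]; show -(-t₀) ∈ s; rw [neg_neg]; exact ht₀
      · rw [max_eq_left h]; exact hu
    refine hforall _ hu' (le_max_left _ _) ?_
    have hle : -max u (-t₀) ≤ t₀ := by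
      have := le_max_right u (-t₀); linarith
    exact hpast _ hu' hle

/-- **A causally convex open neighbourhood of a Cauchy hypersurface is globally hyperbolic with
the same Cauchy hypersurface.** Let `S` be a Cauchy hypersurface of the connected `(M, g, τ)`
(`C^∞` metric) and `V ⊇ S` open with `J⁻(x) ∩ J⁺(S) ⊆ V` and `J⁺(x) ∩ J⁻(S) ⊆ V` for all `x ∈ V`.
Then `S` is a Cauchy hypersurface of `(V, g|_V, τ|_V)`: at most one crossing by
`eq_of_mem_of_mem_opens`, at least one by the previous lemma and its time dual (a point of an
endless timelike curve of `V` off `S` lies in `I⁺(S)` or `I⁻(S)`, O'Neill 1983, Lemma 14.29).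
[cite: ONeillSemiRiemannian1983, Ch. 14, Thm. 14.38 and Lemma 14.40 (pp. 421–423)] -/
theorem IsCauchyHypersurface.restrict_of_causallyConvex [ConnectedSpace M] (hn : (∞ : ℕ∞ω) ≤ n)
    (hres : PseudoRiemannianMetric.contMDiff_restrict (I := I) (n := n) (M := M))
    (hτ : τ.contMDiff_restrict) {S : Set M} (hS : g.IsCauchyHypersurface τ S) {V : Opens M}
    (hSV : S ⊆ V) (hconv : ∀ x ∈ V, g.causalPast τ {x} ∩ g.causalFuture τ S ⊆ V)
    (hconv' : ∀ x ∈ V, g.causalFuture τ {x} ∩ g.causalPast τ S ⊆ V) :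
    (g.restrict hres V).IsCauchyHypersurface (τ.restrict hres hτ V) (Subtype.val ⁻¹' S) := by
  have hn2 : (2 : ℕ∞ω) ≤ n := le_trans (WithTop.coe_le_coe.mpr le_top) hn
  intro γ s hγ
  -- at most one crossing
  suffices hex : ∃ t ∈ s, (γ t : M) ∈ S by
    obtain ⟨t₁, ht₁, h₁⟩ := hex
    exact ⟨t₁, ⟨ht₁, h₁⟩, fun t₂ ht₂ ↦
      IsCauchyHypersurface.eq_of_mem_of_mem_opens hres hτ hn2 hS hγ.1 hγ.2.1 ht₂.1 ht₁ ht₂.2 h₁⟩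
  by_contra hcon
  push Not at hcon
  obtain ⟨t₀, ht₀⟩ := hγ.2.2.1.1
  have hxS : (γ t₀ : M) ∉ S := hcon t₀ ht₀
  have _ := hSV
  rcases hS.mem_chronologicalFuture_union_chronologicalPast hn2 hxS with hx | hx
  · exact hS.false_of_isEndlessTimelikeCurve_of_mem_chronologicalFuture τ hn hres hτ hconv hγ hcon
      ht₀ hx
  · -- time dual: reverse `τ` and the parameter
    have hγ' : (g.restrict hres V).IsEndlessTimelikeCurve
        (τ.reverse.restrict hres (τ.contMDiff_restrict_reverse hτ) V) (fun t ↦ γ (-t))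
        (Neg.neg ⁻¹' s) := by
      rw [← TimeOrientation.restrict_reverse τ hres hτ V]
      exact ⟨ordConnected_preimage_neg hγ.1, hγ.2.1.comp_neg,
        isFutureEndless_comp_neg_iff.mpr hγ.2.2.2, isPastEndless_comp_neg_iff.mpr hγ.2.2.1⟩
    have hconvr : ∀ x ∈ V, g.causalPast τ.reverse {x} ∩ g.causalFuture τ.reverse S ⊆ V := by
      intro x hxV
      rw [causalPast_reverse]
      exact hconv' x hxV
    exact hS.reverse.false_of_isEndlessTimelikeCurve_of_mem_chronologicalFuture τ.reverse hn hres
      (τ.contMDiff_restrict_reverse hτ) hconvr hγ' (fun t ht ↦ hcon (-t) ht)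
      (show -t₀ ∈ Neg.neg ⁻¹' s by show -(-t₀) ∈ s; rw [neg_neg]; exact ht₀)
      (by show ((γ (-(-t₀)) : V) : M) ∈ g.chronologicalFuture τ.reverse S; rw [neg_neg]; exact hx)

/-! ### The causal shadow neighbourhood -/

omit [CompleteSpace E] [g.HasLeviCivita]
  [CovariantDerivative.ContMDiffCovariantDerivative g.leviCivita 1] in
/-- **The past shadow of a point of a Cauchy hypersurface lies in it**: for `x ∈ S`,
`J⁻(x) ∩ J⁺(S) ⊆ S` (a point `y ≤ x` of `J⁺(S) ∖ S` lies in `I⁺(S)`, and then so would `x`, by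
push-up — against achronality). O'Neill 1983, Ch. 14, Lemma 14.29 and Cor. 14.1.
[cite: ONeillSemiRiemannian1983, Ch. 14, Lemma 14.29 (p. 415)] -/
theorem IsCauchyHypersurface.causalPast_inter_causalFuture_subset_of_mem (hn : 2 ≤ n) {S : Set M}
    (hS : g.IsCauchyHypersurface τ S) {x : M} (hx : x ∈ S) :
    g.causalPast τ {x} ∩ g.causalFuture τ S ⊆ S := by
  have hn1 : (1 : ℕ∞ω) ≤ n := le_trans one_le_two hn
  rintro y ⟨hyx, hyS⟩
  by_contra hyS'
  have hyI : y ∈ g.chronologicalFuture τ S :=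
    hS.mem_chronologicalFuture_of_mem_causalFuture_diff hn hyS hyS'
  have hxI : x ∈ g.chronologicalFuture τ S :=
    mem_chronologicalFuture_of_mem_chronologicalFuture_of_mem_causalFuture_set hn1 hyI
      (mem_causalPast_singleton_iff.1 hyx)
  obtain ⟨z, hzS, γ, a, b, hab, hγ, hγa, hγb⟩ := hxI
  exact (IsCauchyHypersurface.isAchronal_holds hn hS) z hzS x hx ⟨z, rfl, γ, a, b, hab, hγ, hγa, hγb⟩

omit [CompleteSpace E] [g.HasLeviCivita]
  [CovariantDerivative.ContMDiffCovariantDerivative g.leviCivita 1] in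
/-- **`J⁺(S) ∩ J⁻(S) = S` for a Cauchy hypersurface** (the inclusion `⊆`): a point of
`J⁺(S) ∖ S` lies in `I⁺(S)`, which is disjoint from `J⁻(S)`. O'Neill 1983, Ch. 14, Lemma 14.29.
[cite: ONeillSemiRiemannian1983, Ch. 14, Lemma 14.29 (p. 415)] -/
theorem IsCauchyHypersurface.causalFuture_inter_causalPast_subset (hn : 2 ≤ n) {S : Set M}
    (hS : g.IsCauchyHypersurface τ S) : g.causalFuture τ S ∩ g.causalPast τ S ⊆ S := by
  rintro w ⟨hwJ, hwP⟩
  by_contra hwS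
  have hwI : w ∈ g.chronologicalFuture τ S := hS.mem_chronologicalFuture_of_mem_causalFuture_diff hn hwJ hwS
  have hdisj := hS.reverse.disjoint_causalFuture_chronologicalPast (τ := τ.reverse) hn
  rw [chronologicalPast_reverse] at hdisj
  exact Set.disjoint_left.1 hdisj hwP hwI

/-- **The set of points whose past shadow lies in `U` is open.** For a Cauchy hypersurface `S` of
`(M, g, τ)` (`C^∞` metric) and an open `U`, `{x | J⁻(x) ∩ J⁺(S) ⊆ U}` is open: if `x_j → x₀` with
points `y_j ∈ J⁻(x_j) ∩ J⁺(S) ∖ U`, then for `p ≫ x₀` eventually `y_j ∈ J⁻(p) ∩ J⁺(S)`, a compact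
set (O'Neill 1983, Lemma 14.40), so `y_j` sub-converge to some `y₀ ∉ U`, `y₀ ∈ J⁺(S)` (closed)
and `y₀ ≤ x₀` (the causal relation is closed, O'Neill 1983, Lemma 14.22).
[cite: ONeillSemiRiemannian1983, Ch. 14, Lemma 14.22 (p. 412) and Lemma 14.40 (p. 423)] -/
theorem IsCauchyHypersurface.isOpen_setOf_causalPast_inter_causalFuture_subset (hn : (∞ : ℕ∞ω) ≤ n)
    {S : Set M} (hS : g.IsCauchyHypersurface τ S) (U : Opens M) :
    IsOpen {x : M | g.causalPast τ {x} ∩ g.causalFuture τ S ⊆ U} := by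
  classical
  have hn2 : (2 : ℕ∞ω) ≤ n := le_trans (WithTop.coe_le_coe.mpr le_top) hn
  haveI : LocallyCompactSpace M := Manifold.locallyCompact_of_finiteDimensional (M := M) I
  haveI : TopologicalSpace.MetrizableSpace M := Manifold.metrizableSpace I M
  letI : MetricSpace M := TopologicalSpace.metrizableSpaceMetric M
  rw [← isClosed_compl_iff]
  refine isClosed_of_closure_subset fun x₀ hx₀ ↦ ?_
  obtain ⟨u, hu, hulim⟩ := mem_closure_iff_seq_limit.1 hx₀
  have hu' : ∀ j, ∃ y, y ∈ g.causalPast τ {u j} ∩ g.causalFuture τ S ∧ y ∉ (U : Set M) := fun j ↦ by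
    have h := hu j
    simp only [mem_compl_iff, mem_setOf_eq, not_subset] at h
    obtain ⟨y, hy, hyU⟩ := h
    exact ⟨y, hy, hyU⟩
  choose y hy hyU using hu'
  -- a point `p ≫ x₀`; eventually `u j ≪ p`
  obtain ⟨p, hp⟩ := exists_mem_chronologicalFuture_singleton (g := g) (τ := τ) hn2 x₀
  have hx₀p : x₀ ∈ g.chronologicalPast τ {p} := mem_chronologicalPast_of_mem_chronologicalFuture hp
  have hev : ∀ᶠ j in atTop, u j ∈ g.chronologicalPast τ {p} :=
    hulim.eventually ((isOpen_chronologicalFuture_of_boundaryless _ _ _).mem_nhds hx₀p)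
  -- the compact set `K = J⁻(p) ∩ J⁺(S)` eventually contains the `y j`
  set K : Set M := g.causalPast τ {p} ∩ g.causalFuture τ S with hK
  have hKc : IsCompact K := hS.isCompact_causalPast_inter_causalFuture hn p
  have hyK : ∀ᶠ j in atTop, y j ∈ K := by
    filter_upwards [hev] with j hj
    refine ⟨mem_causalPast_singleton_iff.2 ?_, (hy j).2⟩
    exact mem_causalFuture_of_mem_causalFuture_of_mem_causalFuture hn2
      (mem_causalPast_singleton_iff.1 (hy j).1)
      (chronologicalFuture_subset_causalFuture _ _ _ (mem_chronologicalFuture_of_mem_chronologicalPast hj))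
  obtain ⟨y₀, -, φ, hφ, hylim⟩ := hKc.tendsto_subseq' hyK.frequently
  -- the limit `y₀` witnesses `x₀ ∉ {…}`
  have hy₀U : y₀ ∉ (U : Set M) :=
    U.isOpen.isClosed_compl.mem_of_tendsto hylim (Eventually.of_forall fun j ↦ hyU (φ j))
  have hy₀S : y₀ ∈ g.causalFuture τ S :=
    (hS.isClosed_causalFuture_set hn2).mem_of_tendsto hylim (Eventually.of_forall fun j ↦ (hy (φ j)).2)
  have hy₀x : y₀ ∈ g.causalPast τ {x₀} := by
    refine mem_causalPast_singleton_iff.2 (hS.mem_causalFuture_of_tendsto hn hylim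
      (hulim.comp hφ.tendsto_atTop) fun k ↦ ?_)
    exact mem_causalPast_singleton_iff.1 (hy (φ k)).1
  simp only [mem_compl_iff, mem_setOf_eq, not_subset]
  exact ⟨y₀, ⟨hy₀x, hy₀S⟩, hy₀U⟩

/-- **The causal shadow neighbourhood.** Let `S` be a Cauchy hypersurface of the connected
`(M, g, τ)` (`C^∞` metric) and `U ⊇ S` open. Then there is an open `V` with `S ⊆ V ⊆ U` which is
causally convex relative to `S` (`J⁻(x) ∩ J⁺(S) ⊆ V` and `J⁺(x) ∩ J⁻(S) ⊆ V` for all `x ∈ V`) and of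
which `S` is a Cauchy hypersurface: `V = {x | J⁻(x) ∩ J⁺(S) ⊆ U ∧ J⁺(x) ∩ J⁻(S) ⊆ U}`.
O'Neill 1983, Ch. 14, Thm. 14.38 / Hawking–Ellis 1973, Prop. 6.6.3 (the interior of the Cauchy
development is globally hyperbolic), in the form needed to start continuation arguments from a
neighbourhood of `S` (Moncrief 1975, §III).
[cite: ONeillSemiRiemannian1983, Ch. 14, Thm. 14.38 and Lemma 14.40 (pp. 421–423)] -/
theorem IsCauchyHypersurface.exists_causallyConvex_opens_subset [ConnectedSpace M]
    (hn : (∞ : ℕ∞ω) ≤ n)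
    (hres : PseudoRiemannianMetric.contMDiff_restrict (I := I) (n := n) (M := M))
    (hτ : τ.contMDiff_restrict) {S : Set M} (hS : g.IsCauchyHypersurface τ S) {U : Opens M}
    (hSU : S ⊆ U) :
    ∃ V : Opens M, S ⊆ V ∧ (V : Set M) ⊆ U ∧
      (∀ x ∈ V, g.causalPast τ {x} ∩ g.causalFuture τ S ⊆ V) ∧
      (∀ x ∈ V, g.causalFuture τ {x} ∩ g.causalPast τ S ⊆ V) ∧
      (g.restrict hres V).IsCauchyHypersurface (τ.restrict hres hτ V) (Subtype.val ⁻¹' S) := by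
  have hn2 : (2 : ℕ∞ω) ≤ n := le_trans (WithTop.coe_le_coe.mpr le_top) hn
  -- the two shadow conditions, the second being the first for `-τ`
  set A : Set M := {x : M | g.causalPast τ {x} ∩ g.causalFuture τ S ⊆ U} with hA
  set A' : Set M := {x : M | g.causalPast τ.reverse {x} ∩ g.causalFuture τ.reverse S ⊆ U} with hA'
  have hAo : IsOpen A := hS.isOpen_setOf_causalPast_inter_causalFuture_subset τ hn U
  have hA'o : IsOpen A' := hS.reverse.isOpen_setOf_causalPast_inter_causalFuture_subset τ.reverse hn U
  have hA'iff : ∀ x, x ∈ A' ↔ g.causalFuture τ {x} ∩ g.causalPast τ S ⊆ U := fun x ↦ by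
    simp only [hA', mem_setOf_eq, causalPast_reverse]
    rfl
  let V : Opens M := ⟨A ∩ A', hAo.inter hA'o⟩
  -- `S ⊆ V ⊆ U`
  have hSV : S ⊆ V := fun x hx ↦
    ⟨(hS.causalPast_inter_causalFuture_subset_of_mem τ hn2 hx).trans hSU, by
      have h := hS.reverse.causalPast_inter_causalFuture_subset_of_mem τ.reverse hn2 hx
      exact h.trans hSU⟩
  have hVU : (V : Set M) ⊆ U := fun x hx ↦ by
    rcases hS.mem_causalFuture_or_mem_causalPast hn2 x with h | h
    · exact hx.1 ⟨subset_causalFuture (g := g) (τ := τ.reverse) _ rfl, h⟩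
    · exact (hA'iff x).1 hx.2 ⟨subset_causalFuture (g := g) (τ := τ) _ rfl, h⟩
  -- causal convexity relative to `S`
  have hconv : ∀ x ∈ V, g.causalPast τ {x} ∩ g.causalFuture τ S ⊆ V := by
    rintro x ⟨hxA, hxA'⟩ y ⟨hyx, hyS⟩
    refine ⟨fun w hw ↦ hxA ⟨mem_causalPast_singleton_iff.2
      (mem_causalFuture_of_mem_causalFuture_of_mem_causalFuture hn2 (mem_causalPast_singleton_iff.1 hw.1)
        (mem_causalPast_singleton_iff.1 hyx)), hw.2⟩, ?_⟩
    rw [hA'iff]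
    rintro w ⟨hwy, hwS⟩
    have hwJ : w ∈ g.causalFuture τ S := by
      rw [← causalFuture_causalFuture_eq hn2 S, causalFuture_eq_biUnion]
      simp only [mem_iUnion, exists_prop]
      exact ⟨y, hyS, hwy⟩
    exact hSU (hS.causalFuture_inter_causalPast_subset τ hn2 ⟨hwJ, hwS⟩)
  have hconv' : ∀ x ∈ V, g.causalFuture τ {x} ∩ g.causalPast τ S ⊆ V := by
    rintro x ⟨hxA, hxA'⟩ y ⟨hyx, hyS⟩
    have hxA'' := (hA'iff x).1 hxA'
    refine ⟨?_, ?_⟩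
    · rintro w ⟨hwy, hwS⟩
      have hyw : y ∈ g.causalFuture τ {w} := mem_causalPast_singleton_iff.1 hwy
      have hwy' : w ∈ g.causalFuture τ.reverse {y} := mem_causalPast_singleton_iff.2 hyw
      have hwJ : w ∈ g.causalPast τ S := by
        show w ∈ g.causalFuture τ.reverse S
        rw [← causalFuture_causalFuture_eq hn2 S, causalFuture_eq_biUnion]
        simp only [mem_iUnion, exists_prop]
        exact ⟨y, hyS, hwy'⟩
      exact hSU (hS.causalFuture_inter_causalPast_subset τ hn2 ⟨hwS, hwJ⟩)
    · rw [hA'iff]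
      rintro w ⟨hwy, hwS⟩
      exact hxA'' ⟨mem_causalFuture_of_mem_causalFuture_of_mem_causalFuture hn2 hyx hwy, hwS⟩
  exact ⟨V, hSV, hVU, hconv, hconv',
    hS.restrict_of_causallyConvex τ hn hres hτ hSV hconv hconv'⟩

/-- **Every open neighbourhood of a Cauchy hypersurface contains a globally hyperbolic one sharing
it**: for `S` a Cauchy hypersurface of the connected `(M, g, τ)` (`C^∞` metric) and `U ⊇ S` open,
there is an open `V`, `S ⊆ V ⊆ U`, of which `S` is a Cauchy hypersurface. O'Neill 1983, Ch. 14,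
Thm. 14.38; Hawking–Ellis 1973, Prop. 6.6.3.
[cite: ONeillSemiRiemannian1983, Ch. 14, Thm. 14.38 (p. 421)] -/
theorem IsCauchyHypersurface.exists_opens_subset_restrict [ConnectedSpace M] (hn : (∞ : ℕ∞ω) ≤ n)
    (hres : PseudoRiemannianMetric.contMDiff_restrict (I := I) (n := n) (M := M))
    (hτ : τ.contMDiff_restrict) {S : Set M} (hS : g.IsCauchyHypersurface τ S) {U : Opens M}
    (hSU : S ⊆ U) :
    ∃ V : Opens M, S ⊆ V ∧ (V : Set M) ⊆ U ∧
      (g.restrict hres V).IsCauchyHypersurface (τ.restrict hres hτ V) (Subtype.val ⁻¹' S) := by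
  obtain ⟨V, hSV, hVU, -, -, hV⟩ := hS.exists_causallyConvex_opens_subset τ hn hres hτ hSU
  exact ⟨V, hSV, hVU, hV⟩

end LorentzianMetric

end Literature.Geometry.Lorentzian

end
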